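import Mathlib.FieldTheory.RatFunc.AsPolynomial
import Mathlib.FieldTheory.Perfect
import Mathlib.RingTheory.Localization.Integral
import Mathlib.Algebra.Polynomial.Bivariate
import Literature.ModelTheory.ExponentialFields.SemialgebraicC1TriangulationProofs

/-!
# The separable algebraic relation of a one-variable semialgebraic function (Rung 2, file E1)

Solo programme `solo-KontsevichZagierPeriods-informed`, line "Rung 2 of the volume ladder from
Huber–Wüstholz", step L2(a) of `paper/rung2-v2.md`. For a function `f : ℝ → ℝ` whose graph over an
infinite set `S ⊆ ℝ` is `ℚ`-semialgebraic we produce a polynomial `p ∈ ℚ[x][y]` of positive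
`y`-degree with `p(t, f t) = 0` on `S` which is SEPARABLE over `ℚ(x)`, in the concrete form of a
Bézout identity `A p + B ∂_y p = c(x)`, `0 ≠ c ∈ ℚ[x]` (`soloInformed_exists_bezoutRelation`).
Proof: a relation of minimal `y`-degree (Bochnak–Coste–Roy §2.8 gives one relation) is square-free
over `ℚ(x)` — a square factor `u² w` would give the relation `u w` of smaller degree after clearing
denominators — hence separable (characteristic `0`), and the Bézout identity over `ℚ(x)` is cleared
of denominators. Consequence used downstream: at a point of the graph where `∂_y p` vanishes,
`c` vanishes; so the bad points are finitely many and algebraic.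

References: J. Bochnak, M. Coste, M.-F. Roy, *Real Algebraic Geometry* (1998), §2.8, Prop. 8.1.8;
S. Basu, R. Pollack, M.-F. Roy, *Algorithms in Real Algebraic Geometry* (2006), Prop. 2.86.
-/

noncomputable section

open Polynomial Set
open Literature.ModelTheory.ExponentialFields

namespace Summit.KontsevichZagierPeriods.KontsevichZagierPeriods.Theorems

/-! ## 1. Real evaluation of `ℚ[x][y]` -/

/-- Real evaluation `p(t, y)` of `p ∈ ℚ[x][y]` (inner variable `x := t`, outer variable `y`), as a
ring homomorphism. -/
def soloInformedEvR (t y : ℝ) : ℚ[X][X] →+* ℝ :=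
  (evalEvalRingHom t y).comp (mapRingHom (mapRingHom (algebraMap ℚ ℝ)))

/-- Unfolding of `soloInformedEvR`. -/
theorem soloInformedEvR_apply (t y : ℝ) (p : ℚ[X][X]) :
    soloInformedEvR t y p = ((p.map (mapRingHom (algebraMap ℚ ℝ))).evalEval t y) := rfl

/-- Evaluation of a constant (in `y`) polynomial. -/
@[simp] theorem soloInformedEvR_C (t y : ℝ) (c : ℚ[X]) :
    soloInformedEvR t y (C c) = (c.map (algebraMap ℚ ℝ)).eval t := by
  rw [soloInformedEvR_apply, Polynomial.map_C, evalEval_C]; rfl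

/-- Evaluation of the variable `y`. -/
@[simp] theorem soloInformedEvR_X (t y : ℝ) : soloInformedEvR t y X = y := by
  rw [soloInformedEvR_apply, Polynomial.map_X, evalEval_X]

/-- Evaluation of a rational scalar. -/
@[simp] theorem soloInformedEvR_C_C (t y : ℝ) (a : ℚ) :
    soloInformedEvR t y (C (C a)) = (a : ℝ) := by
  rw [soloInformedEvR_C, Polynomial.map_C, eval_C]; rfl

/-- The bivariate polynomial attached to `q ∈ ℚ[X₀, X₁]` (`x := X₀`, `y := X₁`) evaluates as `q`. -/
theorem soloInformedEvR_equivMvPolynomial_symm (q : MvPolynomial (Fin 2) ℚ) (t y : ℝ) :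
    soloInformedEvR t y ((Bivariate.equivMvPolynomial ℚ).symm q) = MvPolynomial.aeval ![t, y] q := by
  induction q using MvPolynomial.induction_on with
  | C a =>
    rw [MvPolynomial.aeval_C]
    have : (Bivariate.equivMvPolynomial ℚ).symm (MvPolynomial.C a) = C (C a) := by
      simp [Bivariate.equivMvPolynomial]
    rw [this, soloInformedEvR_C_C]; rfl
  | add p q hp hq => rw [map_add, map_add, hp, hq, map_add]
  | mul_X p i hp =>
    rw [map_mul, map_mul, hp, map_mul, MvPolynomial.aeval_X]
    congr 1
    fin_cases i
    · have : (Bivariate.equivMvPolynomial ℚ).symm (MvPolynomial.X 0) = C X := by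
        simp [Bivariate.equivMvPolynomial]
      simp [this, soloInformedEvR_C]
    · have : (Bivariate.equivMvPolynomial ℚ).symm (MvPolynomial.X 1) = (X : ℚ[X][X]) := by
        simp [Bivariate.equivMvPolynomial]
      simp [this]

/-! ## 2. One relation -/

/-- **An algebraic relation over `ℚ`.** If the graph `{(t, f t) | t ∈ S} ⊆ ℝ²` is
`ℚ`-semialgebraic, some non-zero `p ∈ ℚ[x][y]` satisfies `p(t, f t) = 0` for `t ∈ S`.
[Basu–Pollack–Roy 2006, Prop. 2.86; Bochnak–Coste–Roy 1998, §2.8] -/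
theorem soloInformed_exists_relation {S : Set ℝ} {f : ℝ → ℝ}
    (hG : IsSemialgebraic ℚ {w : Fin 2 → ℝ | w 0 ∈ S ∧ w 1 = f (w 0)}) :
    ∃ p : ℚ[X][X], p ≠ 0 ∧ ∀ t ∈ S, soloInformedEvR t (f t) p = 0 := by
  obtain ⟨P, ⟨x, hx⟩, hP⟩ :=
    hG.exists_forall_aeval_eq_zero_of_interior_eq_empty (interior_setOf_graph_eq_empty
      Fin.zero_ne_one S f)
  refine ⟨(Bivariate.equivMvPolynomial ℚ).symm P, ?_, fun t ht => ?_⟩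
  · intro h0
    rw [EmbeddingLike.map_eq_zero_iff] at h0
    exact hx (by rw [h0, map_zero])
  · rw [soloInformedEvR_equivMvPolynomial_symm]
    have := hP ![t, f t] ⟨ht, by simp⟩
    exact this

/-! ## 3. The minimal relation is separable -/

/-- The field `ℚ(x)` of rational functions, as the fraction field of `ℚ[x]`. -/
abbrev SoloInformedL : Type := RatFunc ℚ

/-- A relation `p` of `f` on `S` whose `y`-degree is minimal among all non-zero relations. -/
def SoloInformedMinimalRelation (S : Set ℝ) (f : ℝ → ℝ) (p : ℚ[X][X]) : Prop :=
  p ≠ 0 ∧ (∀ t ∈ S, soloInformedEvR t (f t) p = 0) ∧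
    ∀ q : ℚ[X][X], q ≠ 0 → (∀ t ∈ S, soloInformedEvR t (f t) q = 0) → p.natDegree ≤ q.natDegree

/-- A minimal relation exists as soon as one relation exists. -/
theorem soloInformed_exists_minimalRelation {S : Set ℝ} {f : ℝ → ℝ}
    (hG : IsSemialgebraic ℚ {w : Fin 2 → ℝ | w 0 ∈ S ∧ w 1 = f (w 0)}) :
    ∃ p, SoloInformedMinimalRelation S f p := by
  classical
  have hex : ∃ d : ℕ, ∃ p : ℚ[X][X], p ≠ 0 ∧ (∀ t ∈ S, soloInformedEvR t (f t) p = 0) ∧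
      p.natDegree = d := by
    obtain ⟨p, hp0, hp⟩ := soloInformed_exists_relation hG
    exact ⟨p.natDegree, p, hp0, hp, rfl⟩
  obtain ⟨p, hp0, hp, hpd⟩ := Nat.find_spec hex
  refine ⟨p, hp0, hp, fun q hq0 hq => ?_⟩
  rw [hpd]
  exact Nat.find_min' hex ⟨q, hq0, hq, rfl⟩

/-- A minimal relation on an infinite set has positive `y`-degree: a relation of degree `0` is a
non-zero polynomial in `x` alone with infinitely many real roots. -/
theorem SoloInformedMinimalRelation.natDegree_pos {S : Set ℝ} {f : ℝ → ℝ} {p : ℚ[X][X]}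
    (hp : SoloInformedMinimalRelation S f p) (hS : S.Infinite) : 0 < p.natDegree := by
  by_contra h
  rw [not_lt, Nat.le_zero] at h
  have hpC := eq_C_of_natDegree_eq_zero h
  have hc0 : p.coeff 0 ≠ 0 := fun h0 => hp.1 (by rw [hpC, h0, map_zero])
  have hroots : ∀ t ∈ S, ((p.coeff 0).map (algebraMap ℚ ℝ)).IsRoot t := by
    intro t ht
    have := hp.2.1 t ht
    rw [hpC, soloInformedEvR_C] at this
    exact this
  have hzero : (p.coeff 0).map (algebraMap ℚ ℝ) = 0 :=
    eq_zero_of_infinite_isRoot _ (hS.mono fun t ht => hroots t ht)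
  rw [Polynomial.map_eq_zero_iff (algebraMap ℚ ℝ).injective] at hzero
  exact hc0 hzero

/-- Clearing denominators: every `u ∈ ℚ(x)[y]` is `U / d` with `U ∈ ℚ[x][y]`, `0 ≠ d ∈ ℚ[x]`, and
`deg_y U = deg_y u`. -/
theorem soloInformed_exists_clearDenominators (u : SoloInformedL[X]) :
    ∃ (U : ℚ[X][X]) (d : ℚ[X]), d ≠ 0 ∧
      U.map (algebraMap ℚ[X] SoloInformedL) = d • u ∧ U.natDegree = u.natDegree := by
  obtain ⟨d, hd, hU⟩ := IsLocalization.integerNormalization_spec (nonZeroDivisors ℚ[X]) u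
  have hd0 : d ≠ 0 := nonZeroDivisors.ne_zero hd
  refine ⟨_, d, hd0, hU, ?_⟩
  rw [← natDegree_map_eq_of_injective (IsFractionRing.injective ℚ[X] SoloInformedL), hU,
    Algebra.smul_def, Polynomial.algebraMap_apply, natDegree_C_mul]
  rw [Ne, map_eq_zero_iff _ (IsFractionRing.injective ℚ[X] SoloInformedL)]
  exact hd0

/-- `(U W)(t, y) = 0` whenever `(U U W)(t, y) = 0` (a field has no nilpotents). -/
theorem soloInformed_evR_mul_eq_zero_of_sq {t y : ℝ} {U W : ℚ[X][X]}
    (h : soloInformedEvR t y (U * U * W) = 0) : soloInformedEvR t y (U * W) = 0 := by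
  rw [map_mul, map_mul] at h
  rw [map_mul]
  rcases mul_eq_zero.1 h with h | h
  · rcases mul_eq_zero.1 h with h | h <;> exact mul_eq_zero_of_left h _
  · exact mul_eq_zero_of_right _ h

/-- **A minimal relation is square-free over `ℚ(x)`.** -/
theorem SoloInformedMinimalRelation.squarefree {S : Set ℝ} {f : ℝ → ℝ} {p : ℚ[X][X]}
    (hp : SoloInformedMinimalRelation S f p) :
    Squarefree (p.map (algebraMap ℚ[X] SoloInformedL)) := by
  classical
  have hinj : Function.Injective (algebraMap ℚ[X] SoloInformedL) :=
    IsFractionRing.injective ℚ[X] SoloInformedL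
  set q := p.map (algebraMap ℚ[X] SoloInformedL) with hq
  have hq0 : q ≠ 0 := by
    rw [hq, Ne, Polynomial.map_eq_zero_iff hinj]; exact hp.1
  intro u hu
  by_contra hunit
  obtain ⟨w, hw⟩ := hu
  have hu0 : u ≠ 0 := by
    rintro rfl; rw [zero_mul, zero_mul] at hw; exact hq0 hw
  have hw0 : w ≠ 0 := by
    rintro rfl; rw [mul_zero] at hw; exact hq0 hw
  have hdeg_u : 0 < u.natDegree :=
    natDegree_pos_iff_degree_pos.2 (degree_pos_of_ne_zero_of_nonunit hu0 hunit)
  -- clear denominators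
  obtain ⟨U, du, hdu, hU, hUdeg⟩ := soloInformed_exists_clearDenominators u
  obtain ⟨W, dw, hdw, hW, hWdeg⟩ := soloInformed_exists_clearDenominators w
  -- `U² W = (du² dw) · p` in `ℚ[x][y]`
  have hUUW : U * U * W = C (du * du * dw) * p := by
    apply Polynomial.map_injective _ hinj
    rw [Polynomial.map_mul, Polynomial.map_mul, hU, hW, Polynomial.map_mul, Polynomial.map_C, ← hq,
      hw, Algebra.smul_def, Algebra.smul_def, Polynomial.algebraMap_apply,
      Polynomial.algebraMap_apply]
    simp only [map_mul]
    ring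
  -- so `U W` is a relation of smaller degree
  have hUW : ∀ t ∈ S, soloInformedEvR t (f t) (U * W) = 0 := by
    intro t ht
    apply soloInformed_evR_mul_eq_zero_of_sq
    rw [hUUW, map_mul, hp.2.1 t ht, mul_zero]
  have hU0 : U ≠ 0 := by
    intro h; rw [h, Polynomial.map_zero] at hU
    exact hu0 ((smul_eq_zero_iff_right hdu).1 hU.symm)
  have hW0 : W ≠ 0 := by
    intro h; rw [h, Polynomial.map_zero] at hW
    exact hw0 ((smul_eq_zero_iff_right hdw).1 hW.symm)
  have hmin := hp.2.2 (U * W) (mul_ne_zero hU0 hW0) hUW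
  have hdegq : q.natDegree = u.natDegree + u.natDegree + w.natDegree := by
    rw [hw, natDegree_mul (mul_ne_zero hu0 hu0) hw0, natDegree_mul hu0 hu0]
  have hdegp : p.natDegree = q.natDegree := (natDegree_map_eq_of_injective hinj p).symm
  rw [natDegree_mul hU0 hW0, hUdeg, hWdeg, hdegp, hdegq] at hmin
  omega

/-! ## 4. The Bézout identity -/

/-- **Separable algebraic relation with a Bézout identity.** For `f : ℝ → ℝ` with
`ℚ`-semialgebraic graph over an infinite set `S ⊆ ℝ` there are `p, A, B ∈ ℚ[x][y]` and
`0 ≠ c ∈ ℚ[x]` with `deg_y p ≥ 1`, `p(t, f t) = 0` on `S` and `A p + B ∂_y p = c`.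
[Bochnak–Coste–Roy 1998, §2.8, Prop. 8.1.8] -/
theorem soloInformed_exists_bezoutRelation {S : Set ℝ} {f : ℝ → ℝ} (hS : S.Infinite)
    (hG : IsSemialgebraic ℚ {w : Fin 2 → ℝ | w 0 ∈ S ∧ w 1 = f (w 0)}) :
    ∃ (p A B : ℚ[X][X]) (c : ℚ[X]), 0 < p.natDegree ∧ c ≠ 0 ∧ A * p + B * derivative p = C c ∧
      ∀ t ∈ S, soloInformedEvR t (f t) p = 0 := by
  classical
  obtain ⟨p, hp⟩ := soloInformed_exists_minimalRelation hG
  have hinj : Function.Injective (algebraMap ℚ[X] SoloInformedL) :=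
    IsFractionRing.injective ℚ[X] SoloInformedL
  set q := p.map (algebraMap ℚ[X] SoloInformedL) with hq
  have hsep : q.Separable := PerfectField.separable_iff_squarefree.2 hp.squarefree
  obtain ⟨a, b, hab⟩ := hsep
  obtain ⟨A₀, da, hda, hA, -⟩ := soloInformed_exists_clearDenominators a
  obtain ⟨B₀, db, hdb, hB, -⟩ := soloInformed_exists_clearDenominators b
  refine ⟨p, C db * A₀, C da * B₀, da * db, hp.natDegree_pos hS, mul_ne_zero hda hdb, ?_, hp.2.1⟩
  apply Polynomial.map_injective _ hinj
  rw [Polynomial.map_add, Polynomial.map_mul, Polynomial.map_mul, Polynomial.map_mul,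
    Polynomial.map_mul, Polynomial.map_C, Polynomial.map_C, hA, hB, ← Polynomial.derivative_map, ← hq,
    Polynomial.map_C, Algebra.smul_def, Algebra.smul_def, Polynomial.algebraMap_apply,
    Polynomial.algebraMap_apply, map_mul, C_mul]
  linear_combination (C (algebraMap ℚ[X] SoloInformedL da) * C (algebraMap ℚ[X] SoloInformedL db)) * hab

/-- **The bad points are roots of `c`.** With `p, A, B, c` as above: if `p(t, y) = 0` and
`∂_y p(t, y) = 0` then `c(t) = 0`. -/
theorem soloInformed_eval_c_eq_zero_of_bad {p A B : ℚ[X][X]} {c : ℚ[X]}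
    (hbez : A * p + B * derivative p = C c) {t y : ℝ} (h0 : soloInformedEvR t y p = 0)
    (h1 : soloInformedEvR t y (derivative p) = 0) : (c.map (algebraMap ℚ ℝ)).eval t = 0 := by
  have := congrArg (soloInformedEvR t y) hbez
  rw [map_add, map_mul, map_mul, h0, h1, mul_zero, mul_zero, add_zero, soloInformedEvR_C] at this
  exact this.symm

/-- **Finitely many, algebraic bad points.** With `p, A, B, c` as above, the set of `t ∈ S` at which
`∂_y p(t, f t) = 0` is finite and consists of real algebraic numbers. -/
theorem soloInformed_badSet_finite {S : Set ℝ} {f : ℝ → ℝ} {p A B : ℚ[X][X]} {c : ℚ[X]}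
    (hc : c ≠ 0) (hbez : A * p + B * derivative p = C c)
    (hp : ∀ t ∈ S, soloInformedEvR t (f t) p = 0) :
    {t ∈ S | soloInformedEvR t (f t) (derivative p) = 0}.Finite ∧
      ∀ t ∈ S, soloInformedEvR t (f t) (derivative p) = 0 → IsAlgebraic ℚ t := by
  have hc' : c.map (algebraMap ℚ ℝ) ≠ 0 := by
    rwa [Ne, Polynomial.map_eq_zero_iff (algebraMap ℚ ℝ).injective]
  refine ⟨?_, fun t ht h1 => ?_⟩
  · refine ((c.map (algebraMap ℚ ℝ)).roots.toFinset.finite_toSet).subset fun t ht => ?_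
    rw [Finset.mem_coe, Multiset.mem_toFinset, mem_roots hc']
    exact soloInformed_eval_c_eq_zero_of_bad hbez (hp t ht.1) ht.2
  · refine ⟨c, hc, ?_⟩
    have := soloInformed_eval_c_eq_zero_of_bad hbez (hp t ht) h1
    rwa [eval_map, ← aeval_def] at this

end Summit.KontsevichZagierPeriods.KontsevichZagierPeriods.Theorems
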